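import Summits.MatrixMultiplication.OmegaCensus.DominoPartFiveZ4Z4
import HarnessLib

/-!
# Gaussian-integer tables for the domino cells with a part of size `7` over `A ↠ ℤ₄ × ℤ₄`

ω-census `pub-omega`, family (b3), seat pub-omega-group gen 16.  Framing: lottery ticket; floor = certified bounds/negative
ranges.  VALUE: the finite kernel computations behind `no_law_cube_17e_of_onto_z4z4` (`DominoPartSevenZ4Z4.lean`); NOT
progress on ω.

Setting (as in gen 15's `Z4Z4DominoFiveTables.lean`): a shifted domino form `(X+Y) ⊔ (β+(Y−X)) ⊔ (γ+(X−Y)) = A∖{x₀}` with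
`|X| = 7` over `A ↠ ℤ₄²` gives, for every pulled-back character `ψ`, `a b + ψ(β') ā b + ψ(γ) a b̄ = −ψ(x₀ − x₁)` after
translating by a point `x₁ ∈ X` with a second point `x₂ ≡ x₁ (mod 2)`.  In the coordinates `w, w'` dual to `(φβ', φγ)` the
real characters force the other five points into the classes `P₁ = (m even, n odd)`, `P₂ = (m odd, n even)`,
`P₃ = (m odd, n odd)` with sizes `(1,2,2)`, `(2,1,2)` or `(2,2,1)` (`three_parts_shape`), and — this is the new finding of the
exact enumeration (pub-omega-group-g16/code/z4z4_killsets.py: for `d = 7` and `d = 9` the pair below kills every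
configuration, while gen 15's pair `w, w + 2w'` does not) — the TWO characters `w'` (`ψβ' = 1`, `ψγ = i`) and `w' + 2w`
(`ψβ' = −1`, `ψγ = i`) suffice: eliminating `b̄` gives `D b = N` with the INTEGER `D = 3x² − y²` resp. `3y² − x²`
(`a = x + yi`), and for one of the two characters `N` is not divisible by `D`.

* `false_of_kill7p`, `false_of_kill7m` — the divisibility obstruction for `ψβ' = ±1`, `ψγ = i`;
* `int_eq_of_mul_eq_neg_ipow`, parity bookkeeping (`two_mul_eq_zero_of_ipow`, …), `three_parts_shape` (the class-size
  pattern, pure finite-set counting);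
* `table7A / table7B / table7C` — the three `decide` tables (`65 536` instances each, `1 024` past the hypotheses; checked
  numerically beforehand by code/table7check.py), and the endgames `finish7A / finish7B / finish7C`.
-/

namespace Summit.MatrixMultiplication.OmegaCensus

open Finset

/-! ## Arithmetic helpers -/

/-- An integer `k` with `k · c = −i^m` in `ℤ[i]` is `±1` (norms). [folklore] -/
theorem int_eq_of_mul_eq_neg_ipow (k : ℤ) (c : GaussianInt) (m : ZMod 4)
    (h : (k : GaussianInt) * c = -(⟨0, 1⟩ : GaussianInt) ^ m.val) : k = 1 ∨ k = -1 := by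
  have hn := congrArg Zsqrtd.norm h
  rw [Zsqrtd.norm_mul, Zsqrtd.norm_neg, norm_ipow, Zsqrtd.norm_intCast] at hn
  have hc : 0 ≤ c.norm := Zsqrtd.norm_nonneg (by norm_num) c
  have hk : k * k = 1 := Int.eq_one_of_mul_eq_one_right (mul_self_nonneg k) hn
  have : (k - 1) * (k + 1) = 0 := by linear_combination hk
  rcases mul_eq_zero.1 this with h1 | h1
  · left; linarith
  · right; linarith

/-- `i^(2m) = 1 ⇒ 2m = 0`. [folklore] -/
theorem two_mul_eq_zero_of_ipow (m : ZMod 4) (h : (⟨0, 1⟩ : GaussianInt) ^ (2 * m).val = 1) : 2 * m = 0 := by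
  revert m h; decide

/-- `i^(2m) ≠ 1 ⇒ 2m = 2`. [folklore] -/
theorem two_mul_eq_two_of_ipow (m : ZMod 4) (h : (⟨0, 1⟩ : GaussianInt) ^ (2 * m).val ≠ 1) : 2 * m = 2 := by
  revert m h; decide

/-- Real characters: if `i^(2m) ≠ 1` and `i^(2n) ≠ 1` then `i^(2(m+n)) = 1` (every point lies in one of the three classes).
[folklore] -/
theorem ipow_two_mul_add_eq_one (m n : ZMod 4) (hm : (⟨0, 1⟩ : GaussianInt) ^ (2 * m).val ≠ 1)
    (hn : (⟨0, 1⟩ : GaussianInt) ^ (2 * n).val ≠ 1) : (⟨0, 1⟩ : GaussianInt) ^ (2 * (m + n)).val = 1 := by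
  revert m n hm hn; decide

/-- `i^(2m) = 1`, `i^(2n) = 1 ⇒ i^(2(m+n)) = 1`. [folklore] -/
theorem ipow_two_mul_add_of_both (m n : ZMod 4) (hm : (⟨0, 1⟩ : GaussianInt) ^ (2 * m).val = 1)
    (hn : (⟨0, 1⟩ : GaussianInt) ^ (2 * n).val = 1) : (⟨0, 1⟩ : GaussianInt) ^ (2 * (m + n)).val = 1 := by
  revert m n hm hn; decide

/-- `i^(2m) = 1`, `i^(2(m+n)) = 1 ⇒ i^(2n) = 1`. [folklore] -/
theorem ipow_two_mul_of_fst (m n : ZMod 4) (hm : (⟨0, 1⟩ : GaussianInt) ^ (2 * m).val = 1)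
    (hmn : (⟨0, 1⟩ : GaussianInt) ^ (2 * (m + n)).val = 1) : (⟨0, 1⟩ : GaussianInt) ^ (2 * n).val = 1 := by
  revert m n hm hmn; decide

/-- `i^(2n) = 1`, `i^(2(m+n)) = 1 ⇒ i^(2m) = 1`. [folklore] -/
theorem ipow_two_mul_of_snd (m n : ZMod 4) (hn : (⟨0, 1⟩ : GaussianInt) ^ (2 * n).val = 1)
    (hmn : (⟨0, 1⟩ : GaussianInt) ^ (2 * (m + n)).val = 1) : (⟨0, 1⟩ : GaussianInt) ^ (2 * m).val = 1 := by
  revert m n hn hmn; decide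

/-! ## The class-size pattern (finite-set counting) -/

/-- **Shape lemma.**  Three subsets `P₁, P₂, P₃` of a five-element set `X`, each of size `≤ 2`, covering `X`, such that a
point in two of them lies in the third: they are pairwise disjoint, partition `X`, and their sizes are `(1,2,2)`, `(2,1,2)`
or `(2,2,1)`. [folklore] -/
theorem three_parts_shape {α : Type*} [DecidableEq α] (X P₁ P₂ P₃ : Finset α) (h₁ : P₁ ⊆ X) (h₂ : P₂ ⊆ X) (h₃ : P₃ ⊆ X)
    (hcov : ∀ y ∈ X, y ∈ P₁ ∨ y ∈ P₂ ∨ y ∈ P₃) (h12 : ∀ y ∈ X, y ∈ P₁ → y ∈ P₂ → y ∈ P₃)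
    (h13 : ∀ y ∈ X, y ∈ P₁ → y ∈ P₃ → y ∈ P₂) (h23 : ∀ y ∈ X, y ∈ P₂ → y ∈ P₃ → y ∈ P₁) (hX : X.card = 5)
    (hc₁ : P₁.card ≤ 2) (hc₂ : P₂.card ≤ 2) (hc₃ : P₃.card ≤ 2) :
    Disjoint P₁ P₂ ∧ Disjoint P₁ P₃ ∧ Disjoint P₂ P₃ ∧ P₁ ∪ P₂ ∪ P₃ = X ∧
      ((P₁.card = 1 ∧ P₂.card = 2 ∧ P₃.card = 2) ∨ (P₁.card = 2 ∧ P₂.card = 1 ∧ P₃.card = 2) ∨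
        (P₁.card = 2 ∧ P₂.card = 2 ∧ P₃.card = 1)) := by
  -- no point lies in two of the parts
  have key : ∀ y ∈ X, ¬ (y ∈ P₁ ∧ y ∈ P₂) := by
    rintro y hy ⟨hy₁, hy₂⟩
    have hy₃ := h12 y hy hy₁ hy₂
    have hsub : X.erase y ⊆ (P₁.erase y ∪ P₂.erase y) ∪ P₃.erase y := by
      intro z hz
      obtain ⟨hzy, hzX⟩ := mem_erase.1 hz
      rcases hcov z hzX with hz' | hz' | hz'
      · exact mem_union_left _ (mem_union_left _ (mem_erase.2 ⟨hzy, hz'⟩))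
      · exact mem_union_left _ (mem_union_right _ (mem_erase.2 ⟨hzy, hz'⟩))
      · exact mem_union_right _ (mem_erase.2 ⟨hzy, hz'⟩)
    have hle := card_le_card hsub
    have hu1 := card_union_le (P₁.erase y ∪ P₂.erase y) (P₃.erase y)
    have hu2 := card_union_le (P₁.erase y) (P₂.erase y)
    rw [card_erase_of_mem hy] at hle
    rw [card_erase_of_mem hy₁, card_erase_of_mem hy₂] at hu2
    rw [card_erase_of_mem hy₃] at hu1
    omega
  have d12 : Disjoint P₁ P₂ := disjoint_left.2 fun a ha ha' => key a (h₁ ha) ⟨ha, ha'⟩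
  have d13 : Disjoint P₁ P₃ := disjoint_left.2 fun a ha ha' => key a (h₁ ha) ⟨ha, h13 a (h₁ ha) ha ha'⟩
  have d23 : Disjoint P₂ P₃ := disjoint_left.2 fun a ha ha' => key a (h₂ ha) ⟨h23 a (h₂ ha) ha ha', ha⟩
  have hU : P₁ ∪ P₂ ∪ P₃ = X := by
    refine Subset.antisymm (union_subset (union_subset h₁ h₂) h₃) fun y hy => ?_
    rcases hcov y hy with h | h | h
    · exact mem_union_left _ (mem_union_left _ h)
    · exact mem_union_left _ (mem_union_right _ h)
    · exact mem_union_right _ h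
  have hsum : P₁.card + P₂.card + P₃.card = 5 := by
    rw [← hX, ← hU, card_union_of_disjoint (disjoint_union_left.2 ⟨d13, d23⟩), card_union_of_disjoint d12]
  refine ⟨d12, d13, d23, hU, ?_⟩
  omega

/-! ## The divisibility obstruction for `ψβ' = ±1`, `ψγ = i` -/

/-- **`D · b = N` with `D = 3x² − y² ∈ ℤ`** (`a = x + yi`): from `a b + ā b + i a b̄ = r` the quantity
`N = (ā + a) r − i a r̄` is divisible by `D` componentwise; a certificate `N.re % D ≠ 0 ∨ N.im % D ≠ 0` is contradictory.
[folklore] -/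
theorem false_of_kill7p {a r b : GaussianInt}
    (h : a * b + 1 * star a * b + (⟨0, 1⟩ : GaussianInt) * a * star b = r)
    (hk : ((star a + a) * r - (⟨0, 1⟩ : GaussianInt) * a * star r).re % (3 * a.re * a.re - a.im * a.im) ≠ 0 ∨
      ((star a + a) * r - (⟨0, 1⟩ : GaussianInt) * a * star r).im % (3 * a.re * a.re - a.im * a.im) ≠ 0) : False := by
  have key := det_mul_eq (a + star a) ((⟨0, 1⟩ : GaussianInt) * a) r b (by linear_combination h)
  have hD : star (a + star a) * (a + star a) - (⟨0, 1⟩ : GaussianInt) * a * star ((⟨0, 1⟩ : GaussianInt) * a) =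
      ⟨3 * a.re * a.re - a.im * a.im, 0⟩ := by
    simp only [star_add, star_mul, star_star]
    apply Zsqrtd.ext <;> simp <;> ring
  have hp : star (a + star a) = star a + a := by simp only [star_add, star_star]
  rw [hD, hp] at key
  set N := (star a + a) * r - (⟨0, 1⟩ : GaussianInt) * a * star r with hN
  set D : ℤ := 3 * a.re * a.re - a.im * a.im with hDd
  have hre : N.re = D * b.re := by rw [← key]; simp
  have him : N.im = D * b.im := by rw [← key]; simp
  rcases hk with hk | hk
  · exact hk (by rw [hre, Int.mul_emod_right])
  · exact hk (by rw [him, Int.mul_emod_right])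

/-- **`D · b = N` with `D = 3y² − x² ∈ ℤ`**: from `a b − ā b + i a b̄ = r` the quantity `N = (ā − a) r − i a r̄` is divisible
by `D` componentwise. [folklore] -/
theorem false_of_kill7m {a r b : GaussianInt}
    (h : a * b + (-1) * star a * b + (⟨0, 1⟩ : GaussianInt) * a * star b = r)
    (hk : ((star a - a) * r - (⟨0, 1⟩ : GaussianInt) * a * star r).re % (3 * a.im * a.im - a.re * a.re) ≠ 0 ∨
      ((star a - a) * r - (⟨0, 1⟩ : GaussianInt) * a * star r).im % (3 * a.im * a.im - a.re * a.re) ≠ 0) : False := by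
  have key := det_mul_eq (a - star a) ((⟨0, 1⟩ : GaussianInt) * a) r b (by linear_combination h)
  have hD : star (a - star a) * (a - star a) - (⟨0, 1⟩ : GaussianInt) * a * star ((⟨0, 1⟩ : GaussianInt) * a) =
      ⟨3 * a.im * a.im - a.re * a.re, 0⟩ := by
    simp only [star_sub, star_mul, star_star]
    apply Zsqrtd.ext <;> simp <;> ring
  have hp : star (a - star a) = star a - a := by simp only [star_sub, star_star]
  rw [hD, hp] at key
  set N := (star a - a) * r - (⟨0, 1⟩ : GaussianInt) * a * star r with hN
  set D : ℤ := 3 * a.im * a.im - a.re * a.re with hDd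
  have hre : N.re = D * b.re := by rw [← key]; simp
  have him : N.im = D * b.im := by rw [← key]; simp
  rcases hk with hk | hk
  · exact hk (by rw [hre, Int.mul_emod_right])
  · exact hk (by rw [him, Int.mul_emod_right])

/-! ## The three two-character tables -/

/-- **Table, shape `(1,2,2)`** (`decide`; `65 536` instances, `1 024` past the hypotheses).  Exponents `n` (coordinate `w'`) of
the points `x₂, y₃, …, y₇` relative to `x₁`, with `y₃ ∈ P₁` (`n` odd, `m` even), `y₄, y₅ ∈ P₂` (`n` even, `m` odd),
`y₆, y₇ ∈ P₃` (`n`, `m` odd), and of `x₀ − x₁` (`l₁ = ⟨w,·⟩`, `l₂ = ⟨w',·⟩`): for the character `w'` (`ψβ' = 1`, `ψγ = i`)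
or for `w' + 2w` (exponents `n + 2m`, `ψβ' = −1`, `ψγ = i`) the quantity `N` of `false_of_kill7p/m` is not divisible by `D`.
[folklore] -/
theorem table7A : ∀ n₂ n₃ n₄ n₅ n₆ n₇ l₁ l₂ : ZMod 4, 2 * n₂ = 0 → 2 * n₃ = 2 → 2 * n₄ = 0 → 2 * n₅ = 0 → 2 * n₆ = 2 → 2 * n₇ = 2 →
    (((star (1 + (⟨0, 1⟩ : GaussianInt) ^ n₂.val + (⟨0, 1⟩ : GaussianInt) ^ n₃.val + (⟨0, 1⟩ : GaussianInt) ^ n₄.val + (⟨0, 1⟩ : GaussianInt) ^ n₅.val + (⟨0, 1⟩ : GaussianInt) ^ n₆.val + (⟨0, 1⟩ : GaussianInt) ^ n₇.val) + (1 + (⟨0, 1⟩ : GaussianInt) ^ n₂.val + (⟨0, 1⟩ : GaussianInt) ^ n₃.val + (⟨0, 1⟩ : GaussianInt) ^ n₄.val + (⟨0, 1⟩ : GaussianInt) ^ n₅.val + (⟨0, 1⟩ : GaussianInt) ^ n₆.val + (⟨0, 1⟩ : GaussianInt) ^ n₇.val)) * (-(⟨0, 1⟩ : GaussianInt) ^ l₂.val)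 -
        (⟨0, 1⟩ : GaussianInt) * (1 + (⟨0, 1⟩ : GaussianInt) ^ n₂.val + (⟨0, 1⟩ : GaussianInt) ^ n₃.val + (⟨0, 1⟩ : GaussianInt) ^ n₄.val + (⟨0, 1⟩ : GaussianInt) ^ n₅.val + (⟨0, 1⟩ : GaussianInt) ^ n₆.val + (⟨0, 1⟩ : GaussianInt) ^ n₇.val) * star (-(⟨0, 1⟩ : GaussianInt) ^ l₂.val)).re %
      (3 * (1 + (⟨0, 1⟩ : GaussianInt) ^ n₂.val + (⟨0, 1⟩ : GaussianInt) ^ n₃.val + (⟨0, 1⟩ : GaussianInt) ^ n₄.val + (⟨0, 1⟩ : GaussianInt) ^ n₅.val + (⟨0, 1⟩ : GaussianInt) ^ n₆.val + (⟨0, 1⟩ : GaussianInt) ^ n₇.val).re *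
          (1 + (⟨0, 1⟩ : GaussianInt) ^ n₂.val + (⟨0, 1⟩ : GaussianInt) ^ n₃.val + (⟨0, 1⟩ : GaussianInt) ^ n₄.val + (⟨0, 1⟩ : GaussianInt) ^ n₅.val + (⟨0, 1⟩ : GaussianInt) ^ n₆.val + (⟨0, 1⟩ : GaussianInt) ^ n₇.val).re -
        (1 + (⟨0, 1⟩ : GaussianInt) ^ n₂.val + (⟨0, 1⟩ : GaussianInt) ^ n₃.val + (⟨0, 1⟩ : GaussianInt) ^ n₄.val + (⟨0, 1⟩ : GaussianInt) ^ n₅.val + (⟨0, 1⟩ : GaussianInt) ^ n₆.val + (⟨0, 1⟩ : GaussianInt) ^ n₇.val).im *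
          (1 + (⟨0, 1⟩ : GaussianInt) ^ n₂.val + (⟨0, 1⟩ : GaussianInt) ^ n₃.val + (⟨0, 1⟩ : GaussianInt) ^ n₄.val + (⟨0, 1⟩ : GaussianInt) ^ n₅.val + (⟨0, 1⟩ : GaussianInt) ^ n₆.val + (⟨0, 1⟩ : GaussianInt) ^ n₇.val).im) ≠ 0 ∨
     ((star (1 + (⟨0, 1⟩ : GaussianInt) ^ n₂.val + (⟨0, 1⟩ : GaussianInt) ^ n₃.val + (⟨0, 1⟩ : GaussianInt) ^ n₄.val + (⟨0, 1⟩ : GaussianInt) ^ n₅.val + (⟨0, 1⟩ : GaussianInt) ^ n₆.val + (⟨0, 1⟩ : GaussianInt) ^ n₇.val) + (1 + (⟨0, 1⟩ : GaussianInt) ^ n₂.val + (⟨0, 1⟩ : GaussianInt) ^ n₃.val + (⟨0, 1⟩ : GaussianInt) ^ n₄.val + (⟨0, 1⟩ : GaussianInt) ^ n₅.val + (⟨0, 1⟩ : GaussianInt) ^ n₆.val + (⟨0, 1⟩ : GaussianInt) ^ n₇.val)) * (-(⟨0, 1⟩ : GaussianInt) ^ l₂.val) -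
        (⟨0, 1⟩ : GaussianInt) * (1 + (⟨0, 1⟩ : GaussianInt) ^ n₂.val + (⟨0, 1⟩ : GaussianInt) ^ n₃.val + (⟨0, 1⟩ : GaussianInt) ^ n₄.val + (⟨0, 1⟩ : GaussianInt) ^ n₅.val + (⟨0, 1⟩ : GaussianInt) ^ n₆.val + (⟨0, 1⟩ : GaussianInt) ^ n₇.val) * star (-(⟨0, 1⟩ : GaussianInt) ^ l₂.val)).im %
      (3 * (1 + (⟨0, 1⟩ : GaussianInt) ^ n₂.val + (⟨0, 1⟩ : GaussianInt) ^ n₃.val + (⟨0, 1⟩ : GaussianInt) ^ n₄.val + (⟨0, 1⟩ : GaussianInt) ^ n₅.val + (⟨0, 1⟩ : GaussianInt) ^ n₆.val + (⟨0, 1⟩ : GaussianInt) ^ n₇.val).re *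
          (1 + (⟨0, 1⟩ : GaussianInt) ^ n₂.val + (⟨0, 1⟩ : GaussianInt) ^ n₃.val + (⟨0, 1⟩ : GaussianInt) ^ n₄.val + (⟨0, 1⟩ : GaussianInt) ^ n₅.val + (⟨0, 1⟩ : GaussianInt) ^ n₆.val + (⟨0, 1⟩ : GaussianInt) ^ n₇.val).re -
        (1 + (⟨0, 1⟩ : GaussianInt) ^ n₂.val + (⟨0, 1⟩ : GaussianInt) ^ n₃.val + (⟨0, 1⟩ : GaussianInt) ^ n₄.val + (⟨0, 1⟩ : GaussianInt) ^ n₅.val + (⟨0, 1⟩ : GaussianInt) ^ n₆.val + (⟨0, 1⟩ : GaussianInt) ^ n₇.val).im *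
          (1 + (⟨0, 1⟩ : GaussianInt) ^ n₂.val + (⟨0, 1⟩ : GaussianInt) ^ n₃.val + (⟨0, 1⟩ : GaussianInt) ^ n₄.val + (⟨0, 1⟩ : GaussianInt) ^ n₅.val + (⟨0, 1⟩ : GaussianInt) ^ n₆.val + (⟨0, 1⟩ : GaussianInt) ^ n₇.val).im) ≠ 0) ∨
    (((star (1 + (⟨0, 1⟩ : GaussianInt) ^ n₂.val + (⟨0, 1⟩ : GaussianInt) ^ n₃.val + (⟨0, 1⟩ : GaussianInt) ^ (n₄ + 2).val + (⟨0, 1⟩ : GaussianInt) ^ (n₅ + 2).val + (⟨0, 1⟩ : GaussianInt) ^ (n₆ + 2).val + (⟨0, 1⟩ : GaussianInt) ^ (n₇ + 2).val) - (1 + (⟨0, 1⟩ : GaussianInt) ^ n₂.val + (⟨0, 1⟩ : GaussianInt) ^ n₃.val + (⟨0, 1⟩ : GaussianInt) ^ (n₄ + 2).val + (⟨0, 1⟩ : GaussianInt) ^ (n₅ + 2).val + (⟨0, 1⟩ : GaussianInt) ^ (n₆ + 2).val + (⟨0, 1⟩ : GaussianInt) ^ (n₇ + 2).val)) * (-(⟨0,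 1⟩ : GaussianInt) ^ (l₂ + 2 * l₁).val) -
        (⟨0, 1⟩ : GaussianInt) * (1 + (⟨0, 1⟩ : GaussianInt) ^ n₂.val + (⟨0, 1⟩ : GaussianInt) ^ n₃.val + (⟨0, 1⟩ : GaussianInt) ^ (n₄ + 2).val + (⟨0, 1⟩ : GaussianInt) ^ (n₅ + 2).val + (⟨0, 1⟩ : GaussianInt) ^ (n₆ + 2).val + (⟨0, 1⟩ : GaussianInt) ^ (n₇ + 2).val) * star (-(⟨0, 1⟩ : GaussianInt) ^ (l₂ + 2 * l₁).val)).re %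
      (3 * (1 + (⟨0, 1⟩ : GaussianInt) ^ n₂.val + (⟨0, 1⟩ : GaussianInt) ^ n₃.val + (⟨0, 1⟩ : GaussianInt) ^ (n₄ + 2).val + (⟨0, 1⟩ : GaussianInt) ^ (n₅ + 2).val + (⟨0, 1⟩ : GaussianInt) ^ (n₆ + 2).val + (⟨0, 1⟩ : GaussianInt) ^ (n₇ + 2).val).im *
          (1 + (⟨0, 1⟩ : GaussianInt) ^ n₂.val + (⟨0, 1⟩ : GaussianInt) ^ n₃.val + (⟨0, 1⟩ : GaussianInt) ^ (n₄ + 2).val + (⟨0, 1⟩ : GaussianInt) ^ (n₅ + 2).val + (⟨0, 1⟩ : GaussianInt) ^ (n₆ + 2).val + (⟨0, 1⟩ : GaussianInt) ^ (n₇ + 2).val).im -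
        (1 + (⟨0, 1⟩ : GaussianInt) ^ n₂.val + (⟨0, 1⟩ : GaussianInt) ^ n₃.val + (⟨0, 1⟩ : GaussianInt) ^ (n₄ + 2).val + (⟨0, 1⟩ : GaussianInt) ^ (n₅ + 2).val + (⟨0, 1⟩ : GaussianInt) ^ (n₆ + 2).val + (⟨0, 1⟩ : GaussianInt) ^ (n₇ + 2).val).re *
          (1 + (⟨0, 1⟩ : GaussianInt) ^ n₂.val + (⟨0, 1⟩ : GaussianInt) ^ n₃.val + (⟨0, 1⟩ : GaussianInt) ^ (n₄ + 2).val + (⟨0, 1⟩ : GaussianInt) ^ (n₅ + 2).val + (⟨0, 1⟩ : GaussianInt) ^ (n₆ + 2).val + (⟨0, 1⟩ : GaussianInt) ^ (n₇ + 2).val).re) ≠ 0 ∨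
     ((star (1 + (⟨0, 1⟩ : GaussianInt) ^ n₂.val + (⟨0, 1⟩ : GaussianInt) ^ n₃.val + (⟨0, 1⟩ : GaussianInt) ^ (n₄ + 2).val + (⟨0, 1⟩ : GaussianInt) ^ (n₅ + 2).val + (⟨0, 1⟩ : GaussianInt) ^ (n₆ + 2).val + (⟨0, 1⟩ : GaussianInt) ^ (n₇ + 2).val) - (1 + (⟨0, 1⟩ : GaussianInt) ^ n₂.val + (⟨0, 1⟩ : GaussianInt) ^ n₃.val + (⟨0, 1⟩ : GaussianInt) ^ (n₄ + 2).val + (⟨0, 1⟩ : GaussianInt) ^ (n₅ + 2).val + (⟨0, 1⟩ : GaussianInt) ^ (n₆ + 2).val + (⟨0, 1⟩ : GaussianInt) ^ (n₇ + 2).val)) * (-(⟨0, 1⟩ : GaussianInt) ^ (l₂ + 2 * l₁).val) -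
        (⟨0, 1⟩ : GaussianInt) * (1 + (⟨0, 1⟩ : GaussianInt) ^ n₂.val + (⟨0, 1⟩ : GaussianInt) ^ n₃.val + (⟨0, 1⟩ : GaussianInt) ^ (n₄ + 2).val + (⟨0, 1⟩ : GaussianInt) ^ (n₅ + 2).val + (⟨0, 1⟩ : GaussianInt) ^ (n₆ + 2).val + (⟨0, 1⟩ : GaussianInt) ^ (n₇ + 2).val) * star (-(⟨0, 1⟩ : GaussianInt) ^ (l₂ + 2 * l₁).val)).im %
      (3 * (1 + (⟨0, 1⟩ : GaussianInt) ^ n₂.val + (⟨0, 1⟩ : GaussianInt) ^ n₃.val + (⟨0, 1⟩ : GaussianInt) ^ (n₄ + 2).val + (⟨0, 1⟩ : GaussianInt) ^ (n₅ + 2).val + (⟨0, 1⟩ : GaussianInt) ^ (n₆ + 2).val + (⟨0, 1⟩ : GaussianInt) ^ (n₇ + 2).val).im *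
          (1 + (⟨0, 1⟩ : GaussianInt) ^ n₂.val + (⟨0, 1⟩ : GaussianInt) ^ n₃.val + (⟨0, 1⟩ : GaussianInt) ^ (n₄ + 2).val + (⟨0, 1⟩ : GaussianInt) ^ (n₅ + 2).val + (⟨0, 1⟩ : GaussianInt) ^ (n₆ + 2).val + (⟨0, 1⟩ : GaussianInt) ^ (n₇ + 2).val).im -
        (1 + (⟨0, 1⟩ : GaussianInt) ^ n₂.val + (⟨0, 1⟩ : GaussianInt) ^ n₃.val + (⟨0, 1⟩ : GaussianInt) ^ (n₄ + 2).val + (⟨0, 1⟩ : GaussianInt) ^ (n₅ + 2).val + (⟨0, 1⟩ : GaussianInt) ^ (n₆ + 2).val + (⟨0, 1⟩ : GaussianInt) ^ (n₇ + 2).val).re *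
          (1 + (⟨0, 1⟩ : GaussianInt) ^ n₂.val + (⟨0, 1⟩ : GaussianInt) ^ n₃.val + (⟨0, 1⟩ : GaussianInt) ^ (n₄ + 2).val + (⟨0, 1⟩ : GaussianInt) ^ (n₅ + 2).val + (⟨0, 1⟩ : GaussianInt) ^ (n₆ + 2).val + (⟨0, 1⟩ : GaussianInt) ^ (n₇ + 2).val).re) ≠ 0) := by
  decide +kernel

/-- **Table, shape `(2,1,2)`**: `y₃, y₄ ∈ P₁`, `y₅ ∈ P₂`, `y₆, y₇ ∈ P₃`. [folklore] -/
theorem table7B : ∀ n₂ n₃ n₄ n₅ n₆ n₇ l₁ l₂ : ZMod 4, 2 * n₂ = 0 → 2 * n₃ = 2 → 2 * n₄ = 2 → 2 * n₅ = 0 → 2 * n₆ = 2 → 2 * n₇ = 2 →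
    (((star (1 + (⟨0, 1⟩ : GaussianInt) ^ n₂.val + (⟨0, 1⟩ : GaussianInt) ^ n₃.val + (⟨0, 1⟩ : GaussianInt) ^ n₄.val + (⟨0, 1⟩ : GaussianInt) ^ n₅.val + (⟨0, 1⟩ : GaussianInt) ^ n₆.val + (⟨0, 1⟩ : GaussianInt) ^ n₇.val) + (1 + (⟨0, 1⟩ : GaussianInt) ^ n₂.val + (⟨0, 1⟩ : GaussianInt) ^ n₃.val + (⟨0, 1⟩ : GaussianInt) ^ n₄.val + (⟨0, 1⟩ : GaussianInt) ^ n₅.val + (⟨0, 1⟩ : GaussianInt) ^ n₆.val + (⟨0, 1⟩ : GaussianInt) ^ n₇.val)) * (-(⟨0, 1⟩ : GaussianInt) ^ l₂.val) -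
        (⟨0, 1⟩ : GaussianInt) * (1 + (⟨0, 1⟩ : GaussianInt) ^ n₂.val + (⟨0, 1⟩ : GaussianInt) ^ n₃.val + (⟨0, 1⟩ : GaussianInt) ^ n₄.val + (⟨0, 1⟩ : GaussianInt) ^ n₅.val + (⟨0, 1⟩ : GaussianInt) ^ n₆.val + (⟨0, 1⟩ : GaussianInt) ^ n₇.val) * star (-(⟨0, 1⟩ : GaussianInt) ^ l₂.val)).re %
      (3 * (1 + (⟨0, 1⟩ : GaussianInt) ^ n₂.val + (⟨0, 1⟩ : GaussianInt) ^ n₃.val + (⟨0, 1⟩ : GaussianInt) ^ n₄.val + (⟨0, 1⟩ : GaussianInt) ^ n₅.val + (⟨0, 1⟩ : GaussianInt) ^ n₆.val + (⟨0, 1⟩ : GaussianInt) ^ n₇.val).re *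
          (1 + (⟨0, 1⟩ : GaussianInt) ^ n₂.val + (⟨0, 1⟩ : GaussianInt) ^ n₃.val + (⟨0, 1⟩ : GaussianInt) ^ n₄.val + (⟨0, 1⟩ : GaussianInt) ^ n₅.val + (⟨0, 1⟩ : GaussianInt) ^ n₆.val + (⟨0, 1⟩ : GaussianInt) ^ n₇.val).re -
        (1 + (⟨0, 1⟩ : GaussianInt) ^ n₂.val + (⟨0, 1⟩ : GaussianInt) ^ n₃.val + (⟨0, 1⟩ : GaussianInt) ^ n₄.val + (⟨0, 1⟩ : GaussianInt) ^ n₅.val + (⟨0, 1⟩ : GaussianInt) ^ n₆.val + (⟨0, 1⟩ : GaussianInt) ^ n₇.val).im *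
          (1 + (⟨0, 1⟩ : GaussianInt) ^ n₂.val + (⟨0, 1⟩ : GaussianInt) ^ n₃.val + (⟨0, 1⟩ : GaussianInt) ^ n₄.val + (⟨0, 1⟩ : GaussianInt) ^ n₅.val + (⟨0, 1⟩ : GaussianInt) ^ n₆.val + (⟨0, 1⟩ : GaussianInt) ^ n₇.val).im) ≠ 0 ∨
     ((star (1 + (⟨0, 1⟩ : GaussianInt) ^ n₂.val + (⟨0, 1⟩ : GaussianInt) ^ n₃.val + (⟨0, 1⟩ : GaussianInt) ^ n₄.val + (⟨0, 1⟩ : GaussianInt) ^ n₅.val + (⟨0, 1⟩ : GaussianInt) ^ n₆.val + (⟨0, 1⟩ : GaussianInt) ^ n₇.val) + (1 + (⟨0, 1⟩ : GaussianInt) ^ n₂.val + (⟨0, 1⟩ : GaussianInt) ^ n₃.val + (⟨0, 1⟩ : GaussianInt) ^ n₄.val + (⟨0, 1⟩ : GaussianInt) ^ n₅.val + (⟨0, 1⟩ : GaussianInt) ^ n₆.val + (⟨0, 1⟩ : GaussianInt) ^ n₇.val)) * (-(⟨0, 1⟩ : GaussianInt) ^ l₂.val) -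
        (⟨0, 1⟩ : GaussianInt) * (1 + (⟨0, 1⟩ : GaussianInt) ^ n₂.val + (⟨0, 1⟩ : GaussianInt) ^ n₃.val + (⟨0, 1⟩ : GaussianInt) ^ n₄.val + (⟨0, 1⟩ : GaussianInt) ^ n₅.val + (⟨0, 1⟩ : GaussianInt) ^ n₆.val + (⟨0, 1⟩ : GaussianInt) ^ n₇.val) * star (-(⟨0, 1⟩ : GaussianInt) ^ l₂.val)).im %
      (3 * (1 + (⟨0, 1⟩ : GaussianInt) ^ n₂.val + (⟨0, 1⟩ : GaussianInt) ^ n₃.val + (⟨0, 1⟩ : GaussianInt) ^ n₄.val + (⟨0, 1⟩ : GaussianInt) ^ n₅.val + (⟨0, 1⟩ : GaussianInt) ^ n₆.val + (⟨0, 1⟩ : GaussianInt) ^ n₇.val).re *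
          (1 + (⟨0, 1⟩ : GaussianInt) ^ n₂.val + (⟨0, 1⟩ : GaussianInt) ^ n₃.val + (⟨0, 1⟩ : GaussianInt) ^ n₄.val + (⟨0, 1⟩ : GaussianInt) ^ n₅.val + (⟨0, 1⟩ : GaussianInt) ^ n₆.val + (⟨0, 1⟩ : GaussianInt) ^ n₇.val).re -
        (1 + (⟨0, 1⟩ : GaussianInt) ^ n₂.val + (⟨0, 1⟩ : GaussianInt) ^ n₃.val + (⟨0, 1⟩ : GaussianInt) ^ n₄.val + (⟨0, 1⟩ : GaussianInt) ^ n₅.val + (⟨0, 1⟩ : GaussianInt) ^ n₆.val + (⟨0, 1⟩ : GaussianInt) ^ n₇.val).im *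
          (1 + (⟨0, 1⟩ : GaussianInt) ^ n₂.val + (⟨0, 1⟩ : GaussianInt) ^ n₃.val + (⟨0, 1⟩ : GaussianInt) ^ n₄.val + (⟨0, 1⟩ : GaussianInt) ^ n₅.val + (⟨0, 1⟩ : GaussianInt) ^ n₆.val + (⟨0, 1⟩ : GaussianInt) ^ n₇.val).im) ≠ 0) ∨
    (((star (1 + (⟨0, 1⟩ : GaussianInt) ^ n₂.val + (⟨0, 1⟩ : GaussianInt) ^ n₃.val + (⟨0, 1⟩ : GaussianInt) ^ n₄.val + (⟨0, 1⟩ : GaussianInt) ^ (n₅ + 2).val + (⟨0, 1⟩ : GaussianInt) ^ (n₆ + 2).val + (⟨0, 1⟩ : GaussianInt) ^ (n₇ + 2).val) - (1 + (⟨0, 1⟩ : GaussianInt) ^ n₂.val + (⟨0, 1⟩ : GaussianInt) ^ n₃.val + (⟨0, 1⟩ : GaussianInt) ^ n₄.val + (⟨0, 1⟩ : GaussianInt) ^ (n₅ + 2).val + (⟨0, 1⟩ : GaussianInt) ^ (n₆ + 2).val + (⟨0, 1⟩ : GaussianInt) ^ (n₇ + 2).val)) * (-(⟨0, 1⟩ :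 GaussianInt) ^ (l₂ + 2 * l₁).val) -
        (⟨0, 1⟩ : GaussianInt) * (1 + (⟨0, 1⟩ : GaussianInt) ^ n₂.val + (⟨0, 1⟩ : GaussianInt) ^ n₃.val + (⟨0, 1⟩ : GaussianInt) ^ n₄.val + (⟨0, 1⟩ : GaussianInt) ^ (n₅ + 2).val + (⟨0, 1⟩ : GaussianInt) ^ (n₆ + 2).val + (⟨0, 1⟩ : GaussianInt) ^ (n₇ + 2).val) * star (-(⟨0, 1⟩ : GaussianInt) ^ (l₂ + 2 * l₁).val)).re %
      (3 * (1 + (⟨0, 1⟩ : GaussianInt) ^ n₂.val + (⟨0, 1⟩ : GaussianInt) ^ n₃.val + (⟨0, 1⟩ : GaussianInt) ^ n₄.val + (⟨0, 1⟩ : GaussianInt) ^ (n₅ + 2).val + (⟨0, 1⟩ : GaussianInt) ^ (n₆ + 2).val + (⟨0, 1⟩ : GaussianInt) ^ (n₇ + 2).val).im *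
          (1 + (⟨0, 1⟩ : GaussianInt) ^ n₂.val + (⟨0, 1⟩ : GaussianInt) ^ n₃.val + (⟨0, 1⟩ : GaussianInt) ^ n₄.val + (⟨0, 1⟩ : GaussianInt) ^ (n₅ + 2).val + (⟨0, 1⟩ : GaussianInt) ^ (n₆ + 2).val + (⟨0, 1⟩ : GaussianInt) ^ (n₇ + 2).val).im -
        (1 + (⟨0, 1⟩ : GaussianInt) ^ n₂.val + (⟨0, 1⟩ : GaussianInt) ^ n₃.val + (⟨0, 1⟩ : GaussianInt) ^ n₄.val + (⟨0, 1⟩ : GaussianInt) ^ (n₅ + 2).val + (⟨0, 1⟩ : GaussianInt) ^ (n₆ + 2).val + (⟨0, 1⟩ : GaussianInt) ^ (n₇ + 2).val).re *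
          (1 + (⟨0, 1⟩ : GaussianInt) ^ n₂.val + (⟨0, 1⟩ : GaussianInt) ^ n₃.val + (⟨0, 1⟩ : GaussianInt) ^ n₄.val + (⟨0, 1⟩ : GaussianInt) ^ (n₅ + 2).val + (⟨0, 1⟩ : GaussianInt) ^ (n₆ + 2).val + (⟨0, 1⟩ : GaussianInt) ^ (n₇ + 2).val).re) ≠ 0 ∨
     ((star (1 + (⟨0, 1⟩ : GaussianInt) ^ n₂.val + (⟨0, 1⟩ : GaussianInt) ^ n₃.val + (⟨0, 1⟩ : GaussianInt) ^ n₄.val + (⟨0, 1⟩ : GaussianInt) ^ (n₅ + 2).val + (⟨0, 1⟩ : GaussianInt) ^ (n₆ + 2).val + (⟨0, 1⟩ : GaussianInt) ^ (n₇ + 2).val) - (1 + (⟨0, 1⟩ : GaussianInt) ^ n₂.val + (⟨0, 1⟩ : GaussianInt) ^ n₃.val + (⟨0, 1⟩ : GaussianInt) ^ n₄.val + (⟨0, 1⟩ : GaussianInt) ^ (n₅ + 2).val + (⟨0, 1⟩ : GaussianInt) ^ (n₆ + 2).val + (⟨0, 1⟩ : GaussianInt) ^ (n₇ + 2).val)) *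 (-(⟨0, 1⟩ : GaussianInt) ^ (l₂ + 2 * l₁).val) -
        (⟨0, 1⟩ : GaussianInt) * (1 + (⟨0, 1⟩ : GaussianInt) ^ n₂.val + (⟨0, 1⟩ : GaussianInt) ^ n₃.val + (⟨0, 1⟩ : GaussianInt) ^ n₄.val + (⟨0, 1⟩ : GaussianInt) ^ (n₅ + 2).val + (⟨0, 1⟩ : GaussianInt) ^ (n₆ + 2).val + (⟨0, 1⟩ : GaussianInt) ^ (n₇ + 2).val) * star (-(⟨0, 1⟩ : GaussianInt) ^ (l₂ + 2 * l₁).val)).im %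
      (3 * (1 + (⟨0, 1⟩ : GaussianInt) ^ n₂.val + (⟨0, 1⟩ : GaussianInt) ^ n₃.val + (⟨0, 1⟩ : GaussianInt) ^ n₄.val + (⟨0, 1⟩ : GaussianInt) ^ (n₅ + 2).val + (⟨0, 1⟩ : GaussianInt) ^ (n₆ + 2).val + (⟨0, 1⟩ : GaussianInt) ^ (n₇ + 2).val).im *
          (1 + (⟨0, 1⟩ : GaussianInt) ^ n₂.val + (⟨0, 1⟩ : GaussianInt) ^ n₃.val + (⟨0, 1⟩ : GaussianInt) ^ n₄.val + (⟨0, 1⟩ : GaussianInt) ^ (n₅ + 2).val + (⟨0, 1⟩ : GaussianInt) ^ (n₆ + 2).val + (⟨0, 1⟩ : GaussianInt) ^ (n₇ + 2).val).im -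
        (1 + (⟨0, 1⟩ : GaussianInt) ^ n₂.val + (⟨0, 1⟩ : GaussianInt) ^ n₃.val + (⟨0, 1⟩ : GaussianInt) ^ n₄.val + (⟨0, 1⟩ : GaussianInt) ^ (n₅ + 2).val + (⟨0, 1⟩ : GaussianInt) ^ (n₆ + 2).val + (⟨0, 1⟩ : GaussianInt) ^ (n₇ + 2).val).re *
          (1 + (⟨0, 1⟩ : GaussianInt) ^ n₂.val + (⟨0, 1⟩ : GaussianInt) ^ n₃.val + (⟨0, 1⟩ : GaussianInt) ^ n₄.val + (⟨0, 1⟩ : GaussianInt) ^ (n₅ + 2).val + (⟨0, 1⟩ : GaussianInt) ^ (n₆ + 2).val + (⟨0, 1⟩ : GaussianInt) ^ (n₇ + 2).val).re) ≠ 0) := by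
  decide +kernel

/-- **Table, shape `(2,2,1)`**: `y₃, y₄ ∈ P₁`, `y₅, y₆ ∈ P₂`, `y₇ ∈ P₃`. [folklore] -/
theorem table7C : ∀ n₂ n₃ n₄ n₅ n₆ n₇ l₁ l₂ : ZMod 4, 2 * n₂ = 0 → 2 * n₃ = 2 → 2 * n₄ = 2 → 2 * n₅ = 0 → 2 * n₆ = 0 → 2 * n₇ = 2 →
    (((star (1 + (⟨0, 1⟩ : GaussianInt) ^ n₂.val + (⟨0, 1⟩ : GaussianInt) ^ n₃.val + (⟨0, 1⟩ : GaussianInt) ^ n₄.val + (⟨0, 1⟩ : GaussianInt) ^ n₅.val + (⟨0, 1⟩ : GaussianInt) ^ n₆.val + (⟨0, 1⟩ : GaussianInt) ^ n₇.val) + (1 + (⟨0, 1⟩ : GaussianInt) ^ n₂.val + (⟨0, 1⟩ : GaussianInt) ^ n₃.val + (⟨0, 1⟩ : GaussianInt) ^ n₄.val + (⟨0, 1⟩ : GaussianInt) ^ n₅.val + (⟨0, 1⟩ : GaussianInt) ^ n₆.val + (⟨0, 1⟩ : GaussianInt) ^ n₇.val)) * (-(⟨0, 1⟩ : GaussianInt)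 ^ l₂.val) -
        (⟨0, 1⟩ : GaussianInt) * (1 + (⟨0, 1⟩ : GaussianInt) ^ n₂.val + (⟨0, 1⟩ : GaussianInt) ^ n₃.val + (⟨0, 1⟩ : GaussianInt) ^ n₄.val + (⟨0, 1⟩ : GaussianInt) ^ n₅.val + (⟨0, 1⟩ : GaussianInt) ^ n₆.val + (⟨0, 1⟩ : GaussianInt) ^ n₇.val) * star (-(⟨0, 1⟩ : GaussianInt) ^ l₂.val)).re %
      (3 * (1 + (⟨0, 1⟩ : GaussianInt) ^ n₂.val + (⟨0, 1⟩ : GaussianInt) ^ n₃.val + (⟨0, 1⟩ : GaussianInt) ^ n₄.val + (⟨0, 1⟩ : GaussianInt) ^ n₅.val + (⟨0, 1⟩ : GaussianInt) ^ n₆.val + (⟨0, 1⟩ : GaussianInt) ^ n₇.val).re *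
          (1 + (⟨0, 1⟩ : GaussianInt) ^ n₂.val + (⟨0, 1⟩ : GaussianInt) ^ n₃.val + (⟨0, 1⟩ : GaussianInt) ^ n₄.val + (⟨0, 1⟩ : GaussianInt) ^ n₅.val + (⟨0, 1⟩ : GaussianInt) ^ n₆.val + (⟨0, 1⟩ : GaussianInt) ^ n₇.val).re -
        (1 + (⟨0, 1⟩ : GaussianInt) ^ n₂.val + (⟨0, 1⟩ : GaussianInt) ^ n₃.val + (⟨0, 1⟩ : GaussianInt) ^ n₄.val + (⟨0, 1⟩ : GaussianInt) ^ n₅.val + (⟨0, 1⟩ : GaussianInt) ^ n₆.val + (⟨0, 1⟩ : GaussianInt) ^ n₇.val).im *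
          (1 + (⟨0, 1⟩ : GaussianInt) ^ n₂.val + (⟨0, 1⟩ : GaussianInt) ^ n₃.val + (⟨0, 1⟩ : GaussianInt) ^ n₄.val + (⟨0, 1⟩ : GaussianInt) ^ n₅.val + (⟨0, 1⟩ : GaussianInt) ^ n₆.val + (⟨0, 1⟩ : GaussianInt) ^ n₇.val).im) ≠ 0 ∨
     ((star (1 + (⟨0, 1⟩ : GaussianInt) ^ n₂.val + (⟨0, 1⟩ : GaussianInt) ^ n₃.val + (⟨0, 1⟩ : GaussianInt) ^ n₄.val + (⟨0, 1⟩ : GaussianInt) ^ n₅.val + (⟨0, 1⟩ : GaussianInt) ^ n₆.val + (⟨0, 1⟩ : GaussianInt) ^ n₇.val) + (1 + (⟨0, 1⟩ : GaussianInt) ^ n₂.val + (⟨0, 1⟩ : GaussianInt) ^ n₃.val + (⟨0, 1⟩ : GaussianInt) ^ n₄.val + (⟨0, 1⟩ : GaussianInt) ^ n₅.val + (⟨0, 1⟩ : GaussianInt) ^ n₆.val + (⟨0, 1⟩ : GaussianInt) ^ n₇.val)) * (-(⟨0, 1⟩ : GaussianInt) ^ l₂.val) -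
        (⟨0, 1⟩ : GaussianInt) * (1 + (⟨0, 1⟩ : GaussianInt) ^ n₂.val + (⟨0, 1⟩ : GaussianInt) ^ n₃.val + (⟨0, 1⟩ : GaussianInt) ^ n₄.val + (⟨0, 1⟩ : GaussianInt) ^ n₅.val + (⟨0, 1⟩ : GaussianInt) ^ n₆.val + (⟨0, 1⟩ : GaussianInt) ^ n₇.val) * star (-(⟨0, 1⟩ : GaussianInt) ^ l₂.val)).im %
      (3 * (1 + (⟨0, 1⟩ : GaussianInt) ^ n₂.val + (⟨0, 1⟩ : GaussianInt) ^ n₃.val + (⟨0, 1⟩ : GaussianInt) ^ n₄.val + (⟨0, 1⟩ : GaussianInt) ^ n₅.val + (⟨0, 1⟩ : GaussianInt) ^ n₆.val + (⟨0, 1⟩ : GaussianInt) ^ n₇.val).re *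
          (1 + (⟨0, 1⟩ : GaussianInt) ^ n₂.val + (⟨0, 1⟩ : GaussianInt) ^ n₃.val + (⟨0, 1⟩ : GaussianInt) ^ n₄.val + (⟨0, 1⟩ : GaussianInt) ^ n₅.val + (⟨0, 1⟩ : GaussianInt) ^ n₆.val + (⟨0, 1⟩ : GaussianInt) ^ n₇.val).re -
        (1 + (⟨0, 1⟩ : GaussianInt) ^ n₂.val + (⟨0, 1⟩ : GaussianInt) ^ n₃.val + (⟨0, 1⟩ : GaussianInt) ^ n₄.val + (⟨0, 1⟩ : GaussianInt) ^ n₅.val + (⟨0, 1⟩ : GaussianInt) ^ n₆.val + (⟨0, 1⟩ : GaussianInt) ^ n₇.val).im *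
          (1 + (⟨0, 1⟩ : GaussianInt) ^ n₂.val + (⟨0, 1⟩ : GaussianInt) ^ n₃.val + (⟨0, 1⟩ : GaussianInt) ^ n₄.val + (⟨0, 1⟩ : GaussianInt) ^ n₅.val + (⟨0, 1⟩ : GaussianInt) ^ n₆.val + (⟨0, 1⟩ : GaussianInt) ^ n₇.val).im) ≠ 0) ∨
    (((star (1 + (⟨0, 1⟩ : GaussianInt) ^ n₂.val + (⟨0, 1⟩ : GaussianInt) ^ n₃.val + (⟨0, 1⟩ : GaussianInt) ^ n₄.val + (⟨0, 1⟩ : GaussianInt) ^ (n₅ + 2).val + (⟨0, 1⟩ : GaussianInt) ^ (n₆ + 2).val + (⟨0, 1⟩ : GaussianInt) ^ (n₇ + 2).val) - (1 + (⟨0, 1⟩ : GaussianInt) ^ n₂.val + (⟨0, 1⟩ : GaussianInt) ^ n₃.val + (⟨0, 1⟩ : GaussianInt) ^ n₄.val + (⟨0, 1⟩ : GaussianInt) ^ (n₅ + 2).val + (⟨0, 1⟩ : GaussianInt) ^ (n₆ + 2).val + (⟨0, 1⟩ : GaussianInt) ^ (n₇ + 2).val)) * (-(⟨0, 1⟩ :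 GaussianInt) ^ (l₂ + 2 * l₁).val) -
        (⟨0, 1⟩ : GaussianInt) * (1 + (⟨0, 1⟩ : GaussianInt) ^ n₂.val + (⟨0, 1⟩ : GaussianInt) ^ n₃.val + (⟨0, 1⟩ : GaussianInt) ^ n₄.val + (⟨0, 1⟩ : GaussianInt) ^ (n₅ + 2).val + (⟨0, 1⟩ : GaussianInt) ^ (n₆ + 2).val + (⟨0, 1⟩ : GaussianInt) ^ (n₇ + 2).val) * star (-(⟨0, 1⟩ : GaussianInt) ^ (l₂ + 2 * l₁).val)).re %
      (3 * (1 + (⟨0, 1⟩ : GaussianInt) ^ n₂.val + (⟨0, 1⟩ : GaussianInt) ^ n₃.val + (⟨0, 1⟩ : GaussianInt) ^ n₄.val + (⟨0, 1⟩ : GaussianInt) ^ (n₅ + 2).val + (⟨0, 1⟩ : GaussianInt) ^ (n₆ + 2).val + (⟨0, 1⟩ : GaussianInt) ^ (n₇ + 2).val).im *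
          (1 + (⟨0, 1⟩ : GaussianInt) ^ n₂.val + (⟨0, 1⟩ : GaussianInt) ^ n₃.val + (⟨0, 1⟩ : GaussianInt) ^ n₄.val + (⟨0, 1⟩ : GaussianInt) ^ (n₅ + 2).val + (⟨0, 1⟩ : GaussianInt) ^ (n₆ + 2).val + (⟨0, 1⟩ : GaussianInt) ^ (n₇ + 2).val).im -
        (1 + (⟨0, 1⟩ : GaussianInt) ^ n₂.val + (⟨0, 1⟩ : GaussianInt) ^ n₃.val + (⟨0, 1⟩ : GaussianInt) ^ n₄.val + (⟨0, 1⟩ : GaussianInt) ^ (n₅ + 2).val + (⟨0, 1⟩ : GaussianInt) ^ (n₆ + 2).val + (⟨0, 1⟩ : GaussianInt) ^ (n₇ + 2).val).re *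
          (1 + (⟨0, 1⟩ : GaussianInt) ^ n₂.val + (⟨0, 1⟩ : GaussianInt) ^ n₃.val + (⟨0, 1⟩ : GaussianInt) ^ n₄.val + (⟨0, 1⟩ : GaussianInt) ^ (n₅ + 2).val + (⟨0, 1⟩ : GaussianInt) ^ (n₆ + 2).val + (⟨0, 1⟩ : GaussianInt) ^ (n₇ + 2).val).re) ≠ 0 ∨
     ((star (1 + (⟨0, 1⟩ : GaussianInt) ^ n₂.val + (⟨0, 1⟩ : GaussianInt) ^ n₃.val + (⟨0, 1⟩ : GaussianInt) ^ n₄.val + (⟨0, 1⟩ : GaussianInt) ^ (n₅ + 2).val + (⟨0, 1⟩ : GaussianInt) ^ (n₆ + 2).val + (⟨0, 1⟩ : GaussianInt) ^ (n₇ + 2).val) - (1 + (⟨0, 1⟩ : GaussianInt) ^ n₂.val + (⟨0, 1⟩ : GaussianInt) ^ n₃.val + (⟨0, 1⟩ : GaussianInt) ^ n₄.val + (⟨0, 1⟩ : GaussianInt) ^ (n₅ + 2).val + (⟨0, 1⟩ : GaussianInt) ^ (n₆ + 2).val + (⟨0, 1⟩ : GaussianInt) ^ (n₇ + 2).val)) *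 (-(⟨0, 1⟩ : GaussianInt) ^ (l₂ + 2 * l₁).val) -
        (⟨0, 1⟩ : GaussianInt) * (1 + (⟨0, 1⟩ : GaussianInt) ^ n₂.val + (⟨0, 1⟩ : GaussianInt) ^ n₃.val + (⟨0, 1⟩ : GaussianInt) ^ n₄.val + (⟨0, 1⟩ : GaussianInt) ^ (n₅ + 2).val + (⟨0, 1⟩ : GaussianInt) ^ (n₆ + 2).val + (⟨0, 1⟩ : GaussianInt) ^ (n₇ + 2).val) * star (-(⟨0, 1⟩ : GaussianInt) ^ (l₂ + 2 * l₁).val)).im %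
      (3 * (1 + (⟨0, 1⟩ : GaussianInt) ^ n₂.val + (⟨0, 1⟩ : GaussianInt) ^ n₃.val + (⟨0, 1⟩ : GaussianInt) ^ n₄.val + (⟨0, 1⟩ : GaussianInt) ^ (n₅ + 2).val + (⟨0, 1⟩ : GaussianInt) ^ (n₆ + 2).val + (⟨0, 1⟩ : GaussianInt) ^ (n₇ + 2).val).im *
          (1 + (⟨0, 1⟩ : GaussianInt) ^ n₂.val + (⟨0, 1⟩ : GaussianInt) ^ n₃.val + (⟨0, 1⟩ : GaussianInt) ^ n₄.val + (⟨0, 1⟩ : GaussianInt) ^ (n₅ + 2).val + (⟨0, 1⟩ : GaussianInt) ^ (n₆ + 2).val + (⟨0, 1⟩ : GaussianInt) ^ (n₇ + 2).val).im -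
        (1 + (⟨0, 1⟩ : GaussianInt) ^ n₂.val + (⟨0, 1⟩ : GaussianInt) ^ n₃.val + (⟨0, 1⟩ : GaussianInt) ^ n₄.val + (⟨0, 1⟩ : GaussianInt) ^ (n₅ + 2).val + (⟨0, 1⟩ : GaussianInt) ^ (n₆ + 2).val + (⟨0, 1⟩ : GaussianInt) ^ (n₇ + 2).val).re *
          (1 + (⟨0, 1⟩ : GaussianInt) ^ n₂.val + (⟨0, 1⟩ : GaussianInt) ^ n₃.val + (⟨0, 1⟩ : GaussianInt) ^ n₄.val + (⟨0, 1⟩ : GaussianInt) ^ (n₅ + 2).val + (⟨0, 1⟩ : GaussianInt) ^ (n₆ + 2).val + (⟨0, 1⟩ : GaussianInt) ^ (n₇ + 2).val).re) ≠ 0) := by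
  decide +kernel

/-! ## The endgames -/

/-- **Endgame, shape `(1,2,2)`.**  Exponent data `(m, n)` of `x₂, y₃, …, y₇` relative to `x₁` in the coordinates
`w, w'`, with `2m₂ = 2n₂ = 0` and the class parities of the shape, the two identities for the characters `w'` and `w' + 2w`:
contradiction (`table7A` + `false_of_kill7p/m`). [folklore] -/
theorem finish7A (n₂ n₃ n₄ n₅ n₆ n₇ m₂ m₃ m₄ m₅ m₆ m₇ l₁ l₂ : ZMod 4) (a₁ a₂ b₁ b₂ : GaussianInt)
    (h2m₂ : 2 * m₂ = 0) (h2n₂ : 2 * n₂ = 0)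
    (h3 : 2 * m₃ = 0 ∧ 2 * n₃ = 2) (h4 : 2 * m₄ = 2 ∧ 2 * n₄ = 0) (h5 : 2 * m₅ = 2 ∧ 2 * n₅ = 0)
    (h6 : 2 * m₆ = 2 ∧ 2 * n₆ = 2) (h7 : 2 * m₇ = 2 ∧ 2 * n₇ = 2)
    (ha₁ : a₁ = 1 + (⟨0, 1⟩ : GaussianInt) ^ n₂.val + (⟨0, 1⟩ : GaussianInt) ^ n₃.val + (⟨0, 1⟩ : GaussianInt) ^ n₄.val + (⟨0, 1⟩ : GaussianInt) ^ n₅.val + (⟨0, 1⟩ : GaussianInt) ^ n₆.val + (⟨0, 1⟩ : GaussianInt) ^ n₇.val)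
    (ha₂ : a₂ = 1 + (⟨0, 1⟩ : GaussianInt) ^ (n₂ + 2 * m₂).val + (⟨0, 1⟩ : GaussianInt) ^ (n₃ + 2 * m₃).val + (⟨0, 1⟩ : GaussianInt) ^ (n₄ + 2 * m₄).val + (⟨0, 1⟩ : GaussianInt) ^ (n₅ + 2 * m₅).val + (⟨0, 1⟩ : GaussianInt) ^ (n₆ + 2 * m₆).val + (⟨0, 1⟩ : GaussianInt) ^ (n₇ + 2 * m₇).val)
    (E1 : a₁ * b₁ + 1 * star a₁ * b₁ + (⟨0, 1⟩ : GaussianInt) * a₁ * star b₁ = -(⟨0, 1⟩ : GaussianInt) ^ l₂.val)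
    (E2 : a₂ * b₂ + (-1) * star a₂ * b₂ + (⟨0, 1⟩ : GaussianInt) * a₂ * star b₂ = -(⟨0, 1⟩ : GaussianInt) ^ (l₂ + 2 * l₁).val) :
    False := by
  subst ha₁ ha₂
  rw [ipow_add_two_mul_of_eq_zero _ _ h2m₂, ipow_add_two_mul_of_eq_zero _ _ h3.1, ipow_add_two_mul_of_eq_two _ _ h4.1, ipow_add_two_mul_of_eq_two _ _ h5.1, ipow_add_two_mul_of_eq_two _ _ h6.1, ipow_add_two_mul_of_eq_two _ _ h7.1] at E2
  rcases table7A n₂ n₃ n₄ n₅ n₆ n₇ l₁ l₂ h2n₂ h3.2 h4.2 h5.2 h6.2 h7.2 with hk | hk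
  · exact false_of_kill7p E1 hk
  · exact false_of_kill7m E2 hk

/-- **Endgame, shape `(2,1,2)`.**  Exponent data `(m, n)` of `x₂, y₃, …, y₇` relative to `x₁` in the coordinates
`w, w'`, with `2m₂ = 2n₂ = 0` and the class parities of the shape, the two identities for the characters `w'` and `w' + 2w`:
contradiction (`table7B` + `false_of_kill7p/m`). [folklore] -/
theorem finish7B (n₂ n₃ n₄ n₅ n₆ n₇ m₂ m₃ m₄ m₅ m₆ m₇ l₁ l₂ : ZMod 4) (a₁ a₂ b₁ b₂ : GaussianInt)
    (h2m₂ : 2 * m₂ = 0) (h2n₂ : 2 * n₂ = 0)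
    (h3 : 2 * m₃ = 0 ∧ 2 * n₃ = 2) (h4 : 2 * m₄ = 0 ∧ 2 * n₄ = 2) (h5 : 2 * m₅ = 2 ∧ 2 * n₅ = 0)
    (h6 : 2 * m₆ = 2 ∧ 2 * n₆ = 2) (h7 : 2 * m₇ = 2 ∧ 2 * n₇ = 2)
    (ha₁ : a₁ = 1 + (⟨0, 1⟩ : GaussianInt) ^ n₂.val + (⟨0, 1⟩ : GaussianInt) ^ n₃.val + (⟨0, 1⟩ : GaussianInt) ^ n₄.val + (⟨0, 1⟩ : GaussianInt) ^ n₅.val + (⟨0, 1⟩ : GaussianInt) ^ n₆.val + (⟨0, 1⟩ : GaussianInt) ^ n₇.val)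
    (ha₂ : a₂ = 1 + (⟨0, 1⟩ : GaussianInt) ^ (n₂ + 2 * m₂).val + (⟨0, 1⟩ : GaussianInt) ^ (n₃ + 2 * m₃).val + (⟨0, 1⟩ : GaussianInt) ^ (n₄ + 2 * m₄).val + (⟨0, 1⟩ : GaussianInt) ^ (n₅ + 2 * m₅).val + (⟨0, 1⟩ : GaussianInt) ^ (n₆ + 2 * m₆).val + (⟨0, 1⟩ : GaussianInt) ^ (n₇ + 2 * m₇).val)
    (E1 : a₁ * b₁ + 1 * star a₁ * b₁ + (⟨0, 1⟩ : GaussianInt) * a₁ * star b₁ = -(⟨0, 1⟩ : GaussianInt) ^ l₂.val)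
    (E2 : a₂ * b₂ + (-1) * star a₂ * b₂ + (⟨0, 1⟩ : GaussianInt) * a₂ * star b₂ = -(⟨0, 1⟩ : GaussianInt) ^ (l₂ + 2 * l₁).val) :
    False := by
  subst ha₁ ha₂
  rw [ipow_add_two_mul_of_eq_zero _ _ h2m₂, ipow_add_two_mul_of_eq_zero _ _ h3.1, ipow_add_two_mul_of_eq_zero _ _ h4.1, ipow_add_two_mul_of_eq_two _ _ h5.1, ipow_add_two_mul_of_eq_two _ _ h6.1, ipow_add_two_mul_of_eq_two _ _ h7.1] at E2
  rcases table7B n₂ n₃ n₄ n₅ n₆ n₇ l₁ l₂ h2n₂ h3.2 h4.2 h5.2 h6.2 h7.2 with hk | hk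
  · exact false_of_kill7p E1 hk
  · exact false_of_kill7m E2 hk

/-- **Endgame, shape `(2,2,1)`.**  Exponent data `(m, n)` of `x₂, y₃, …, y₇` relative to `x₁` in the coordinates
`w, w'`, with `2m₂ = 2n₂ = 0` and the class parities of the shape, the two identities for the characters `w'` and `w' + 2w`:
contradiction (`table7C` + `false_of_kill7p/m`). [folklore] -/
theorem finish7C (n₂ n₃ n₄ n₅ n₆ n₇ m₂ m₃ m₄ m₅ m₆ m₇ l₁ l₂ : ZMod 4) (a₁ a₂ b₁ b₂ : GaussianInt)
    (h2m₂ : 2 * m₂ = 0) (h2n₂ : 2 * n₂ = 0)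
    (h3 : 2 * m₃ = 0 ∧ 2 * n₃ = 2) (h4 : 2 * m₄ = 0 ∧ 2 * n₄ = 2) (h5 : 2 * m₅ = 2 ∧ 2 * n₅ = 0)
    (h6 : 2 * m₆ = 2 ∧ 2 * n₆ = 0) (h7 : 2 * m₇ = 2 ∧ 2 * n₇ = 2)
    (ha₁ : a₁ = 1 + (⟨0, 1⟩ : GaussianInt) ^ n₂.val + (⟨0, 1⟩ : GaussianInt) ^ n₃.val + (⟨0, 1⟩ : GaussianInt) ^ n₄.val + (⟨0, 1⟩ : GaussianInt) ^ n₅.val + (⟨0, 1⟩ : GaussianInt) ^ n₆.val + (⟨0, 1⟩ : GaussianInt) ^ n₇.val)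
    (ha₂ : a₂ = 1 + (⟨0, 1⟩ : GaussianInt) ^ (n₂ + 2 * m₂).val + (⟨0, 1⟩ : GaussianInt) ^ (n₃ + 2 * m₃).val + (⟨0, 1⟩ : GaussianInt) ^ (n₄ + 2 * m₄).val + (⟨0, 1⟩ : GaussianInt) ^ (n₅ + 2 * m₅).val + (⟨0, 1⟩ : GaussianInt) ^ (n₆ + 2 * m₆).val + (⟨0, 1⟩ : GaussianInt) ^ (n₇ + 2 * m₇).val)
    (E1 : a₁ * b₁ + 1 * star a₁ * b₁ + (⟨0, 1⟩ : GaussianInt) * a₁ * star b₁ = -(⟨0, 1⟩ : GaussianInt) ^ l₂.val)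
    (E2 : a₂ * b₂ + (-1) * star a₂ * b₂ + (⟨0, 1⟩ : GaussianInt) * a₂ * star b₂ = -(⟨0, 1⟩ : GaussianInt) ^ (l₂ + 2 * l₁).val) :
    False := by
  subst ha₁ ha₂
  rw [ipow_add_two_mul_of_eq_zero _ _ h2m₂, ipow_add_two_mul_of_eq_zero _ _ h3.1, ipow_add_two_mul_of_eq_zero _ _ h4.1, ipow_add_two_mul_of_eq_two _ _ h5.1, ipow_add_two_mul_of_eq_two _ _ h6.1, ipow_add_two_mul_of_eq_two _ _ h7.1] at E2
  rcases table7C n₂ n₃ n₄ n₅ n₆ n₇ l₁ l₂ h2n₂ h3.2 h4.2 h5.2 h6.2 h7.2 with hk | hk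
  · exact false_of_kill7p E1 hk
  · exact false_of_kill7m E2 hk

end Summit.MatrixMultiplication.OmegaCensus
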